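import Summits.SmoothPoincare4.SmoothPoincare4.Theorems.RootDecompAEDoublesShadowTwoRoeExpo

/-!
# Grade-two dichotomy for KMN encoding graphs (Roe certificates), part 11/17: the geometry of a gluing at a piece

§7b `other`, `uport`, `uword`, `ucoef`, `uflip`: the entries of a row at one of its end pieces (`tab_u`, `tab_far`),
no port glued twice (`uport_ne`), evaluation of a substitution killing the far end (`lift_rel_u`); the rows at a piece
`urows` and the two row splits of a peeling step.

THE FAMILY (16 modules `Theorems/RootDecompAEDoublesShadowTwoRoe*.lean` + the closing module
`Theorems/RootDecompAEDoublesShadowTwoStubGradeTwoDichotomy.lean`, one namespace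
`Summit.SmoothPoincare4.SmoothPoincare4.Theorems.RootDecompAEDoublesShadowTwoStubGradeTwoDichotomy`, chained imports,
split by topic to respect the 400-line bound on proof files; the local-table parts import only `…RoeDefs`).
-/

open Function
open Literature.Topology.FourManifolds

set_option linter.dupNamespace false

noncomputable section

namespace Summit.SmoothPoincare4.SmoothPoincare4.Theorems.RootDecompAEDoublesShadowTwoStubGradeTwoDichotomy

namespace ShadowGraph

variable (G₂ : ShadowGraph)

/-! ### The geometry of a gluing `e` at one of its end pieces `u` -/

/-- The other end piece. -/
def other (e : Fin G₂.m) (u : Fin G₂.k) : Fin G₂.k := if (G₂.src e).1 = u then (G₂.tgt e).1 else (G₂.src e).1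

/-- The port of `u` used by `e`. -/
def uport (e : Fin G₂.m) (u : Fin G₂.k) : ℕ := if (G₂.src e).1 = u then (G₂.src e).2 else (G₂.tgt e).2

/-- The port word of `u` used by `e`. -/
def uword (e : Fin G₂.m) (u : Fin G₂.k) : FreeGroup (Fin 3) := (G₂.piece u).portWord (G₂.uport e u)

/-- The sign with which the `u`-letters enter the exponent table in row `e`. -/
def ucoef (e : Fin G₂.m) (u : Fin G₂.k) : ℤ := if (G₂.src e).1 = u then 1 else G₂.osgn e

/-- Whether the `u`-side port word enters the relator inverted. -/
def uflip (e : Fin G₂.m) (u : Fin G₂.k) : Bool := !decide ((G₂.src e).1 = u) && !G₂.sgn e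

/-- The port reference of the `u`-end of `e`. -/
def uref (e : Fin G₂.m) (u : Fin G₂.k) : Fin G₂.m ⊕ Fin G₂.m := if (G₂.src e).1 = u then Sum.inl e else Sum.inr e

variable {G₂}

/-- The port reference of the `u`-end of `e` points at the port `uport e u` of `u`. -/
theorem endpoints_uref₂ {e : Fin G₂.m} {u : Fin G₂.k} (ht : (G₂.src e).1 = u ∨ (G₂.tgt e).1 = u) :
    G₂.endpoints (G₂.uref e u) = (u, G₂.uport e u) := by
  unfold uref uport endpoints
  by_cases hs : (G₂.src e).1 = u
  · simp only [hs, if_true, Sum.elim_inl]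
    exact Prod.ext hs rfl
  · have ht' : (G₂.tgt e).1 = u := ht.resolve_left hs
    simp only [hs, if_false, Sum.elim_inr]
    exact Prod.ext ht' rfl

/-- A gluing between different pieces has its other end away from `u`. -/
theorem other_ne₂ {e : Fin G₂.m} {u : Fin G₂.k} (hself : (G₂.src e).1 ≠ (G₂.tgt e).1) : G₂.other e u ≠ u := by
  unfold other
  by_cases hs : (G₂.src e).1 = u
  · rw [if_pos hs]; rw [hs] at hself; exact fun h => hself h.symm
  · rw [if_neg hs]; exact hs

/-- The two ways a gluing can touch `u`: as its source or as its target. -/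
theorem ends_eq₂ {e : Fin G₂.m} {u : Fin G₂.k} (ht : (G₂.src e).1 = u ∨ (G₂.tgt e).1 = u) :
    ((G₂.src e).1 = u ∧ (G₂.tgt e).1 = G₂.other e u) ∨ ((G₂.tgt e).1 = u ∧ (G₂.src e).1 = G₂.other e u) := by
  unfold other
  by_cases hs : (G₂.src e).1 = u
  · exact Or.inl ⟨hs, by rw [if_pos hs]⟩
  · exact Or.inr ⟨ht.resolve_left hs, by rw [if_neg hs]⟩

/-- A piece different from both ends of `e` sees nothing of row `e`. -/
theorem ne_ends_of_ne₂ {e : Fin G₂.m} {u v : Fin G₂.k} (ht : (G₂.src e).1 = u ∨ (G₂.tgt e).1 = u) (hvu : v ≠ u)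
    (hvo : v ≠ G₂.other e u) : (G₂.src e).1 ≠ v ∧ (G₂.tgt e).1 ≠ v := by
  rcases ends_eq₂ ht with ⟨h1, h2⟩ | ⟨h1, h2⟩
  · exact ⟨fun h => hvu (h.symm.trans h1), fun h => hvo (h.symm.trans h2)⟩
  · exact ⟨fun h => hvo (h.symm.trans h2), fun h => hvu (h.symm.trans h1)⟩

/-- The unordered pair of end pieces of a gluing touching `u`. -/
theorem epair_eq₂ {e : Fin G₂.m} {u : Fin G₂.k} (ht : (G₂.src e).1 = u ∨ (G₂.tgt e).1 = u) :
    G₂.epair e = s(u, G₂.other e u) := by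
  unfold epair
  rcases ends_eq₂ ht with ⟨h1, h2⟩ | ⟨h1, h2⟩
  · rw [h1, ← h2]
  · rw [h1, ← h2, Sym2.eq_swap]

/-- A (tree) gluing touching `u` makes `u` adjacent to its other end. -/
theorem adj_other₂ {e : Fin G₂.m} {u : Fin G₂.k} (hall : ∀ e, G₂.tree e = true) (hself : (G₂.src e).1 ≠ (G₂.tgt e).1)
    (ht : (G₂.src e).1 = u ∨ (G₂.tgt e).1 = u) : G₂.treeAdj.Adj u (G₂.other e u) :=
  (G₂.treeAdj_iff₂ _ _).mpr ⟨(other_ne₂ hself).symm, e, hall e, epair_eq₂ ht⟩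

/-- A gluing with end pair `{u, w}` touches both `u` and `w`. -/
theorem touches_of_epair₂ {e : Fin G₂.m} {u w : Fin G₂.k} (h : G₂.epair e = s(u, w)) :
    ((G₂.src e).1 = u ∨ (G₂.tgt e).1 = u) ∧ ((G₂.src e).1 = w ∨ (G₂.tgt e).1 = w) := by
  unfold epair at h
  rw [Sym2.eq_iff] at h
  rcases h with ⟨h1, h2⟩ | ⟨h1, h2⟩
  · exact ⟨Or.inl h1, Or.inr h2⟩
  · exact ⟨Or.inr h2, Or.inl h1⟩

/-- A gluing with end pair `{u, w}` has other end `w` at `u`. -/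
theorem other_eq_of_epair₂ {e : Fin G₂.m} {u w : Fin G₂.k} (hself : (G₂.src e).1 ≠ (G₂.tgt e).1)
    (h : G₂.epair e = s(u, w)) : G₂.other e u = w := by
  have ht := (touches_of_epair₂ h).1
  have h' := epair_eq₂ ht
  rw [h, Sym2.eq_iff] at h'
  rcases h' with ⟨-, h2⟩ | ⟨h1, -⟩
  · exact h2.symm
  · exact absurd h1.symm (other_ne₂ hself)

/-- The port of `u` used by a gluing exists. -/
theorem uport_lt₂ (hV : G₂.PortsValid) {e : Fin G₂.m} {u : Fin G₂.k} (ht : (G₂.src e).1 = u ∨ (G₂.tgt e).1 = u) :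
    G₂.uport e u < (G₂.piece u).numPorts := by
  unfold uport
  obtain ⟨h1, h2⟩ := hV e
  by_cases hs : (G₂.src e).1 = u
  · rw [if_pos hs, ← hs]; exact h1
  · rw [if_neg hs, ← ht.resolve_left hs]; exact h2

/-- Two different gluings at `u` use different ports of `u` (no port is glued twice). -/
theorem uport_ne₂ (hI : G₂.PortsInjective) {e₁ e₂ : Fin G₂.m} {u : Fin G₂.k} (hne : e₁ ≠ e₂)
    (ht₁ : (G₂.src e₁).1 = u ∨ (G₂.tgt e₁).1 = u) (ht₂ : (G₂.src e₂).1 = u ∨ (G₂.tgt e₂).1 = u) :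
    G₂.uport e₁ u ≠ G₂.uport e₂ u := by
  intro h
  have h12 : G₂.endpoints (G₂.uref e₁ u) = G₂.endpoints (G₂.uref e₂ u) := by
    rw [endpoints_uref₂ ht₁, endpoints_uref₂ ht₂, h]
  have := hI h12
  unfold uref at this
  split_ifs at this <;> simp_all

/-- THE TABLE AT `u`: the entry of a `u`-letter in the row of a gluing at `u` is the signed exponent sum of the letter in the used port word. -/
theorem tab_u {e : Fin G₂.m} {u : Fin G₂.k} (hself : (G₂.src e).1 ≠ (G₂.tgt e).1)
    (ht : (G₂.src e).1 = u ∨ (G₂.tgt e).1 = u) (i : Fin 3) :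
    G₂.tab e (Sum.inl (u, i)) = G₂.ucoef e u * expo i (G₂.uword e u) := by
  unfold tab ucoef uword uport
  rw [expo_inl_gluingRelator, expo_inl_portWordAt, expo_inl_portWordAt]
  by_cases hs : (G₂.src e).1 = u
  · have ht' : (G₂.tgt e).1 ≠ u := fun h => hself (hs.trans h.symm)
    simp only [hs, if_true, ht', if_false, mul_zero, add_zero, one_mul]
  · have ht' : (G₂.tgt e).1 = u := ht.resolve_left hs
    simp only [hs, if_false, ht', if_true, zero_add]

/-- A piece not touched by the gluing `e` contributes nothing to row `e`. -/
theorem tab_far {e : Fin G₂.m} {v : Fin G₂.k} (h1 : (G₂.src e).1 ≠ v) (h2 : (G₂.tgt e).1 ≠ v) (i : Fin 3) :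
    G₂.tab e (Sum.inl (v, i)) = 0 := by
  unfold tab
  rw [expo_inl_gluingRelator, expo_inl_portWordAt, expo_inl_portWordAt, if_neg h1, if_neg h2]
  simp

/-- The sign with which the `u`-letters enter row `e` is a unit. -/
theorem isUnit_ucoef₂ (e : Fin G₂.m) (u : Fin G₂.k) : IsUnit (G₂.ucoef e u) := by
  unfold ucoef; split_ifs; · simp
  · exact G₂.isUnit_osgn₂ e

/-- EVALUATION of a substitution on the relator of a gluing `e` at `u` that kills the stable letter and all letters
of the other end piece: what remains is the (possibly inverted) image of the `u`-side port word. -/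
theorem lift_rel_u {e : Fin G₂.m} {u : Fin G₂.k} (ht : (G₂.src e).1 = u ∨ (G₂.tgt e).1 = u)
    (hself : (G₂.src e).1 ≠ (G₂.tgt e).1) {β : Type} (F : G₂.Gen → FreeGroup β) (hFe : F (Sum.inr e) = 1)
    (hFw : ∀ i, F (Sum.inl (G₂.other e u, i)) = 1) :
    FreeGroup.lift F (G₂.gluingRelator e) = sgnw (G₂.uflip e u) (FreeGroup.lift (F ∘ G₂.ltr u) (G₂.uword e u)) := by
  rw [lift_gluingRelator, hFe]
  unfold uflip uword uport
  rcases ends_eq₂ ht with ⟨h1, h2⟩ | ⟨h1, h2⟩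
  · have hw : F ∘ G₂.ltr (G₂.tgt e).1 = fun _ => 1 := funext fun i => by rw [h2]; exact hFw i
    rw [hw, ← lift_const_one₂]
    simp only [h1, decide_true, Bool.not_true, Bool.false_and, if_true]
    rw [← h1]
    cases G₂.sgn e <;> simp [sgnw]
  · have hw : F ∘ G₂.ltr (G₂.src e).1 = fun _ => 1 := funext fun i => by rw [h2]; exact hFw i
    have hs : (G₂.src e).1 ≠ u := fun h => hself (h.trans h1.symm)
    rw [hw, ← lift_const_one₂]
    simp only [hs, decide_false, Bool.not_false, Bool.true_and]
    rw [← h1]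
    cases G₂.sgn e <;> simp [sgnw]

end ShadowGraph

namespace ShadowGraph

variable (G₂ : ShadowGraph)

/-! ### The set algebra of one peeling step -/

/-- The rows at `u`. -/
def urows (R L : Finset (Fin G₂.k)) (u : Fin G₂.k) : Finset (Fin G₂.m) :=
  (G₂.rows R L).filter fun e => (G₂.src e).1 = u ∨ (G₂.tgt e).1 = u

variable {G₂}

/-- Membership in the rows at `u`. -/
theorem mem_urows₂ {R L : Finset (Fin G₂.k)} {u : Fin G₂.k} {e : Fin G₂.m} :
    e ∈ G₂.urows R L u ↔ e ∈ G₂.rows R L ∧ ((G₂.src e).1 = u ∨ (G₂.tgt e).1 = u) := by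
  simp [urows]

/-- The far end of a row at `u` lies in `R` or in `L`. -/
theorem other_mem₂ {R L : Finset (Fin G₂.k)} {u : Fin G₂.k} {e : Fin G₂.m}
    (he : e ∈ G₂.rows R L) (ht : (G₂.src e).1 = u ∨ (G₂.tgt e).1 = u) :
    G₂.other e u ∈ R ∨ G₂.other e u ∈ L := by
  rw [mem_rows₂] at he
  rcases ends_eq₂ ht with ⟨h1, h2⟩ | ⟨h1, h2⟩
  · rw [← h2]
    rcases he with ⟨-, h⟩ | ⟨h, -⟩
    · exact h
    · exact Or.inl h
  · rw [← h2]
    rcases he with ⟨h, -⟩ | ⟨-, h⟩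
    · exact Or.inl h
    · exact h

/-- TOP split of the rows: the rows at `u`, and the rows of the state `(R ∖ u, L)`, which avoid `u`. -/
theorem rows_split_top₂ {R L : Finset (Fin G₂.k)} {u : Fin G₂.k} (huL : u ∉ L) :
    G₂.rows R L = G₂.urows R L u ∪ G₂.rows (R.erase u) L ∧ Disjoint (G₂.urows R L u) (G₂.rows (R.erase u) L) ∧
      ∀ e ∈ G₂.rows (R.erase u) L, (G₂.src e).1 ≠ u ∧ (G₂.tgt e).1 ≠ u := by
  have havoid : ∀ e ∈ G₂.rows (R.erase u) L, (G₂.src e).1 ≠ u ∧ (G₂.tgt e).1 ≠ u := by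
    intro e he
    rw [mem_rows₂] at he
    simp only [Finset.mem_erase] at he
    constructor
    · rintro h
      rcases he with ⟨⟨h1, -⟩, -⟩ | ⟨-, ⟨h1, -⟩ | h1⟩
      · exact h1 h
      · exact h1 h
      · exact huL (h ▸ h1)
    · rintro h
      rcases he with ⟨-, ⟨h1, -⟩ | h1⟩ | ⟨⟨h1, -⟩, -⟩
      · exact h1 h
      · exact huL (h ▸ h1)
      · exact h1 h
  refine ⟨?_, ?_, havoid⟩
  · ext e
    rw [Finset.mem_union, mem_urows₂]
    constructor
    · intro he
      by_cases ht : (G₂.src e).1 = u ∨ (G₂.tgt e).1 = u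
      · exact Or.inl ⟨he, ht⟩
      · right
        push Not at ht
        rw [mem_rows₂] at he ⊢
        simp only [Finset.mem_erase]
        tauto
    · rintro (⟨he, -⟩ | he)
      · exact he
      · rw [mem_rows₂] at he ⊢
        simp only [Finset.mem_erase] at he
        tauto
  · rw [Finset.disjoint_left]
    intro e he he'
    rw [mem_urows₂] at he
    have := havoid e he'
    tauto

/-- BOTTOM split of the rows: the cap rows `S` at `u` (all rows at `u` except the edge `δ` towards `R`), and the
rows of the state `(R ∖ u, L ∪ {u})`. -/
theorem rows_split_bot₂ {R L : Finset (Fin G₂.k)} {u : Fin G₂.k} (hself : ∀ e, (G₂.src e).1 ≠ (G₂.tgt e).1)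
    (hRL : Disjoint R L) (hu : u ∈ R) (δ : Fin G₂.m) (hδ : δ ∈ G₂.urows R L u) (hδR : G₂.other δ u ∈ R)
    (hS : ∀ e ∈ G₂.urows R L u, e ≠ δ → G₂.other e u ∈ L) :
    G₂.rows R L = (G₂.urows R L u).erase δ ∪ G₂.rows (R.erase u) (insert u L) ∧
      Disjoint ((G₂.urows R L u).erase δ) (G₂.rows (R.erase u) (insert u L)) := by
  have huL : u ∉ L := fun h => Finset.disjoint_left.mp hRL hu h
  constructor
  · ext e
    rw [Finset.mem_union, Finset.mem_erase, mem_urows₂]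
    constructor
    · intro he
      by_cases ht : (G₂.src e).1 = u ∨ (G₂.tgt e).1 = u
      · by_cases hed : e = δ
        · right
          subst hed
          have hne : G₂.other e u ≠ u := other_ne₂ (hself e)
          rw [mem_rows₂]
          simp only [Finset.mem_erase, Finset.mem_insert]
          rcases ends_eq₂ ht with ⟨h1, h2⟩ | ⟨h1, h2⟩
          · right; refine ⟨⟨?_, ?_⟩, Or.inr (Or.inl h1)⟩
            · rw [h2]; exact hne
            · rw [h2]; exact hδR
          · left; refine ⟨⟨?_, ?_⟩, Or.inr (Or.inl h1)⟩
            · rw [h2]; exact hne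
            · rw [h2]; exact hδR
        · exact Or.inl ⟨hed, he, ht⟩
      · right
        push Not at ht
        rw [mem_rows₂] at he ⊢
        simp only [Finset.mem_erase, Finset.mem_insert]
        tauto
    · rintro (⟨-, he, -⟩ | he)
      · exact he
      · rw [mem_rows₂] at he ⊢
        simp only [Finset.mem_erase, Finset.mem_insert] at he
        rcases he with ⟨⟨-, h1⟩, ⟨-, h2⟩ | rfl | h2⟩ | ⟨⟨-, h1⟩, ⟨-, h2⟩ | rfl | h2⟩
        · exact Or.inl ⟨h1, Or.inl h2⟩
        · exact Or.inr ⟨hu, Or.inl h1⟩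
        · exact Or.inl ⟨h1, Or.inr h2⟩
        · exact Or.inr ⟨h1, Or.inl h2⟩
        · exact Or.inl ⟨hu, Or.inl h1⟩
        · exact Or.inr ⟨h1, Or.inr h2⟩
  · rw [Finset.disjoint_left]
    intro e he he'
    rw [Finset.mem_erase, mem_urows₂] at he
    obtain ⟨hed, heR, ht⟩ := he
    have hoL := hS e (mem_urows₂.mpr ⟨heR, ht⟩) hed
    have hoR : G₂.other e u ∉ R.erase u := fun h =>
      Finset.disjoint_left.mp hRL (Finset.mem_of_mem_erase h) hoL
    have huR : u ∉ R.erase u := by simp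
    rw [mem_rows₂] at he'
    rcases ends_eq₂ ht with ⟨h1, h2⟩ | ⟨h1, h2⟩
    · rw [h1, h2] at he'
      rcases he' with ⟨h, -⟩ | ⟨h, -⟩
      · exact huR h
      · exact hoR h
    · rw [h1, h2] at he'
      rcases he' with ⟨h, -⟩ | ⟨h, -⟩
      · exact hoR h
      · exact huR h

end ShadowGraph

end Summit.SmoothPoincare4.SmoothPoincare4.Theorems.RootDecompAEDoublesShadowTwoStubGradeTwoDichotomy
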